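import Literature.NumberTheory.EllipticCurves.Kato2004.IwasawaH1Reduction
import Literature.NumberTheory.GaloisRepresentations.ContinuousCohomologyConnecting
import HarnessLib

/-!
# Algebra of `H¹` along additive equivariant coefficient maps (`mapH1AddHom`): composition, difference,
# identity and zero maps, comparison with `cohomologyMap`, and restriction bookkeeping (proofs)

Topic `NumberTheory/GaloisRepresentations` (namespace = path).  `Proofs`-style file: theorems only (no
definition, no named fact, no `sorry`, no instance).  Cell `bsd-potss`, seat `bsd-potss-rkm` (g8):
bookkeeping for the tree's `mapH1AddHom` (`Kato2004/IwasawaH1Reduction.lean`: functoriality of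
continuous `H¹` along an additive, continuous, equivariant map between topological representations with
possibly different coefficient rings), used by the Shapiro / `Λ`-adic files of Kato (14.14.1) on the pin
(`Kato2004/IwasawaTwistTateShapiroProofs.lean`, `…/IwasawaH1ProjZeroKernelProofs.lean`):

* `mapH1AddHom_mapH1AddHom` (`H¹(g) ∘ H¹(f) = H¹(g ∘ f)`), `mapH1AddHom_congr`, `mapH1AddHom_zero_map`,
  `mapH1AddHom_id_map`, `mapH1AddHom_sub_map` (`H¹(f − f') = H¹(f) − H¹(f')`);
* `cohomologyMap_one_eq_mapH1AddHom` — for a morphism of `TopRep R G`, Mathlib's `cohomologyMap f 1`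
  is `mapH1AddHom` of the underlying additive map;
* `resLe_resLe_apply`, `resLe_refl_apply`, and `exists_resLe_oneCocycleClass_eq` — restriction of an
  explicit class is the class of SOME crossed homomorphism with the restricted values (an existential,
  kernel-light form of `resLe_oneCocycleClass` for use at concrete coefficient modules).

All statements are the degree-one functoriality of continuous cochain cohomology (Serre I §2.2, §2.4).

## References

* J.-P. Serre, *Galois Cohomology* (1997), I §2.2, §2.4. [SerreGaloisCohomology1997]
* Tree: `Kato2004/IwasawaH1Reduction.lean` (`mapH1AddHom`, `mapH1AddHom_oneCocycleClass`),
  `ContinuousCorestriction.lean` (`resLe`, `resLe_oneCocycleClass`), `ContinuousCohomologyConnecting.lean`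
  (`cohomologyMap`).
-/

noncomputable section

open CategoryTheory

namespace Literature.NumberTheory.GaloisRepresentations

section MapH1

universe u u' u'' v

variable {R : Type u} [Ring R] [TopologicalSpace R] {R' : Type u'} [Ring R'] [TopologicalSpace R']
  {R'' : Type u''} [Ring R''] [TopologicalSpace R'']
variable {G : Type v} [Group G] [TopologicalSpace G] [IsTopologicalGroup G]
variable {X : TopRep.{v} R G} {Y : TopRep.{v} R' G} {Z : TopRep.{v} R'' G}

/-- **Functoriality of `mapH1AddHom`**: `H¹(g) ∘ H¹(f) = H¹(g ∘ f)`. [cite: SerreGaloisCohomology1997, I §2.2] -/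
theorem mapH1AddHom_mapH1AddHom (f : X →+ Y) (hf : Continuous f)
    (hfρ : ∀ (σ : G) (x : X), f (X.ρ σ x) = Y.ρ σ (f x)) (g : Y →+ Z) (hg : Continuous g)
    (hgρ : ∀ (σ : G) (y : Y), g (Y.ρ σ y) = Z.ρ σ (g y))
    (hgf : Continuous (g.comp f)) (hgfρ : ∀ (σ : G) (x : X), g.comp f (X.ρ σ x) = Z.ρ σ (g.comp f x))
    (c : continuousCohomology 1 X) :
    mapH1AddHom Y Z g hg hgρ (mapH1AddHom X Y f hf hfρ c) = mapH1AddHom X Z (g.comp f) hgf hgfρ c := by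
  obtain ⟨φ, rfl⟩ := oneCocycleClass_surjective _ c
  rw [mapH1AddHom_oneCocycleClass, mapH1AddHom_oneCocycleClass, mapH1AddHom_oneCocycleClass]
  exact congrArg _ (Subtype.ext (ContinuousMap.ext fun _ => rfl))

/-- `mapH1AddHom` only depends on the underlying function: equal maps give equal `H¹`-maps.
[cite: SerreGaloisCohomology1997, I §2.2] -/
theorem mapH1AddHom_congr {f f' : X →+ Y} (h : f = f') (hf : Continuous f)
    (hfρ : ∀ (σ : G) (x : X), f (X.ρ σ x) = Y.ρ σ (f x)) (hf' : Continuous f')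
    (hf'ρ : ∀ (σ : G) (x : X), f' (X.ρ σ x) = Y.ρ σ (f' x)) (c : continuousCohomology 1 X) :
    mapH1AddHom X Y f hf hfρ c = mapH1AddHom X Y f' hf' hf'ρ c := by
  subst h; rfl

/-- `H¹` of the zero map is zero. [cite: SerreGaloisCohomology1997, I §2.2] -/
theorem mapH1AddHom_zero_map (hf : Continuous (0 : X →+ Y))
    (hfρ : ∀ (σ : G) (x : X), (0 : X →+ Y) (X.ρ σ x) = Y.ρ σ ((0 : X →+ Y) x))
    (c : continuousCohomology 1 X) : mapH1AddHom X Y 0 hf hfρ c = 0 := by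
  obtain ⟨φ, rfl⟩ := oneCocycleClass_surjective _ c
  rw [mapH1AddHom_oneCocycleClass, ← oneCocycleClass_zero]
  exact congrArg _ (Subtype.ext (ContinuousMap.ext fun _ => rfl))

/-- `H¹` of the identity is the identity. [cite: SerreGaloisCohomology1997, I §2.2] -/
theorem mapH1AddHom_id_map (hf : Continuous (AddMonoidHom.id X))
    (hfρ : ∀ (σ : G) (x : X), (AddMonoidHom.id X) (X.ρ σ x) = X.ρ σ ((AddMonoidHom.id X) x))
    (c : continuousCohomology 1 X) : mapH1AddHom X X (AddMonoidHom.id X) hf hfρ c = c := by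
  obtain ⟨φ, rfl⟩ := oneCocycleClass_surjective _ c
  rw [mapH1AddHom_oneCocycleClass]
  exact congrArg _ (Subtype.ext (ContinuousMap.ext fun _ => rfl))

/-- `H¹(f − f') = H¹(f) − H¹(f')` for two maps into the same module.
[cite: SerreGaloisCohomology1997, I §2.2] -/
theorem mapH1AddHom_sub_map (f f' : X →+ Y) (hf : Continuous f)
    (hfρ : ∀ (σ : G) (x : X), f (X.ρ σ x) = Y.ρ σ (f x)) (hf' : Continuous f')
    (hf'ρ : ∀ (σ : G) (x : X), f' (X.ρ σ x) = Y.ρ σ (f' x)) (hs : Continuous (f - f'))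
    (hsρ : ∀ (σ : G) (x : X), (f - f') (X.ρ σ x) = Y.ρ σ ((f - f') x))
    (c : continuousCohomology 1 X) :
    mapH1AddHom X Y (f - f') hs hsρ c = mapH1AddHom X Y f hf hfρ c - mapH1AddHom X Y f' hf' hf'ρ c := by
  obtain ⟨φ, rfl⟩ := oneCocycleClass_surjective _ c
  rw [mapH1AddHom_oneCocycleClass, mapH1AddHom_oneCocycleClass, mapH1AddHom_oneCocycleClass,
    ← oneCocycleClass_sub]
  exact congrArg _ (Subtype.ext (ContinuousMap.ext fun _ => rfl))

/-- **`cohomologyMap` of a `TopRep` morphism is `mapH1AddHom` of its underlying additive map** (same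
formula `[φ] ↦ [f ∘ φ]` on crossed homomorphisms). [cite: SerreGaloisCohomology1997, I §2.2] -/
theorem cohomologyMap_one_eq_mapH1AddHom {A B : TopRep.{v} R G} (f : A ⟶ B) (hf : Continuous f.hom)
    (hfρ : ∀ (σ : G) (x : A), f.hom.toLinearMap.toAddMonoidHom (A.ρ σ x) =
      B.ρ σ (f.hom.toLinearMap.toAddMonoidHom x)) (c : continuousCohomology 1 A) :
    cohomologyMap f 1 c = mapH1AddHom A B f.hom.toLinearMap.toAddMonoidHom hf hfρ c := by
  obtain ⟨φ, rfl⟩ := oneCocycleClass_surjective _ c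
  rw [cohomologyMap_oneCocycleClass, mapH1AddHom_oneCocycleClass]
  exact congrArg _ (Subtype.ext (ContinuousMap.ext fun _ => rfl))

/-- Two successive restrictions are the restriction along the composite inclusion.
[cite: SerreGaloisCohomology1997, I §2.4] -/
theorem resLe_resLe_apply (W' : TopRep.{v} R G) {H H' H'' : Subgroup G} (h : H ≤ H') (h' : H' ≤ H'')
    (c : continuousCohomology 1 (subgroupRep W' H'')) :
    resLe W' h 1 (resLe W' h' 1 c) = resLe W' (h.trans h') 1 c := by
  obtain ⟨ψ, rfl⟩ := oneCocycleClass_surjective _ c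
  rw [resLe_oneCocycleClass, resLe_oneCocycleClass, resLe_oneCocycleClass]
  exact congrArg _ (Subtype.ext (ContinuousMap.ext fun _ => rfl))

/-- Restriction along `H ≤ H` is the identity. [cite: SerreGaloisCohomology1997, I §2.4] -/
theorem resLe_refl_apply (W' : TopRep.{v} R G) {H : Subgroup G}
    (c : continuousCohomology 1 (subgroupRep W' H)) : resLe W' (le_refl H) 1 c = c := by
  obtain ⟨ψ, rfl⟩ := oneCocycleClass_surjective _ c
  rw [resLe_oneCocycleClass]
  exact congrArg _ (Subtype.ext (ContinuousMap.ext fun _ => rfl))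

/-- **Restriction on cocycles, existential form**: `res [φ] = [ψ]` for SOME continuous crossed
homomorphism `ψ` of `H` with `ψ(g) = φ(g)` — a kernel-light way to handle `resLe` of an explicit
class at a concrete coefficient module (the witness is `φ ∘ (H ↪ H')`). [cite: SerreGaloisCohomology1997, I §2.4] -/
theorem exists_resLe_oneCocycleClass_eq (W' : TopRep.{v} R G) {H H' : Subgroup G} (h : H ≤ H')
    (φ : contOneCocycles (subgroupRep W' H')) :
    ∃ ψ : contOneCocycles (subgroupRep W' H), (∀ g : H, ψ.1 g = φ.1 (Subgroup.inclusion h g)) ∧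
      resLe W' h 1 (oneCocycleClass _ φ) = oneCocycleClass _ ψ :=
  ⟨_, fun _ => rfl, resLe_oneCocycleClass W' h φ⟩

end MapH1

end Literature.NumberTheory.GaloisRepresentations


end
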